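import Summits.NavierStokesRegularity.FluidComputer.PalasekTowerLineCrossing
import Summits.NavierStokesRegularity.FluidComputer.TriggeredTransferH1Persistence

/-!
# Door N1-FC: the PRESSURE RATE of one triggered transfer — every `TriggerScheme.Step` is pressure-driven
# at the mean growth rate of its speed maximum, at some instant

Cell `ns-blowup`, seat `ns-blowup-fc-prover-3` (g3; prover; D-0074 GROUP C/E «BRIDGE SUPPORT»;
bears_on LADDER-NS N1-FC door vocabulary `TriggeredTransfer.lean` (p416130) — «Envelope/Transfer lemmas
over `TriggeredTransfer`» of the director's re-point; supports only, nothing claimed). Companion of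
`PalasekTowerLineCrossing.lean` (p446722: `exists_lineCrossing_of_clayContinuation`, the rate form of
first hitting for ANY finite-energy classical Clay flow) and of fc-prover-2's
`TriggeredTransferH1Persistence.lean` (`TriggerScheme.IsTrigger.clayForce`: a trigger is a Clay-class
force). LABEL: E–C typing (KERNEL analysis; every statement PROVED; no `Prop` introduced; no unproved
fact). WHAT THIS IS NOT: not Navier–Stokes evidence — no scheme instance, transfer or blow-up is
asserted; the theorems are NECESSARY CONDITIONS on the components of ANY `TriggerScheme.Step`, which is
an OPEN predicate nobody has instantiated.

## Content

In one triggered transfer (`TriggerScheme.Step ν U ε w`) the classical solution `u` starts from the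
level state `w` and hands over, at time `T ≤ C_τ (1 + |log ε|)^q / U`, the `λ`-zoom of a member `w'` of
the family at amplitude `U' ≥ (ηλ)^{1/2} U`; the zoomed member carries speed `≥ λ c U'` somewhere
(`TriggerScheme.floor`). So if the parent state is bounded by `A < λ c U'`, the global speed maximum
must climb from `≤ A` to `≥ λ c U'` within `T`: by the line crossing, for every slope `0 ≤ Λ` with
`Λ T < λ c U' − A` there is an instant `t⋆ ∈ (0, T]` and a global argmax `x₁` (speed in `(A, λ c U']`,
exceeding every earlier speed) where `ν|Du|²_F + ⟪u, ∇p⟫ + Λ‖u‖ ≤ ⟪u, g⟫ ≤ ε A₀ ‖u‖` — the trigger's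
own push is at most `ε A₀` per unit speed (`IsTrigger.small` at order `0`), so THE PRESSURE GRADIENT
supplies the rate: `ν|Du|²_F + (Λ − ε A₀)‖u‖ ≤ −⟪u, ∇p⟫`
(`exists_lineCrossing_of_trigger`, `exists_pressureRate_of_handover`). With `ε` super-polynomially
small along the cascade and `T ≲ |log ε|^q / U`, the required pressure rate grows like `U · U'`:
each transfer is an autonomous, pressure-driven amplification event — the door's analogue of the
register's hand-over pressure rate (`PalasekTowerHandoverPressureRate.lean`).

References: T. Tao, J. Amer. Math. Soc. 29 (2016) 601–674, §1.3 [cite: Tao2016AveragedNS, §1.3];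
D. Gilbarg, N. Trudinger, *Elliptic PDE of second order*, §3.1 [cite: GilbargTrudinger2001, §3.1].
-/

noncomputable section

namespace Summit.NavierStokesRegularity.FluidComputer.TriggeredTransfer

open Set MeasureTheory Filter Topology Function Real
open scoped ENNReal ContDiff NNReal InnerProductSpace RealInnerProductSpace
open Literature.Analysis.FluidPDE
open Literature.Analysis.FluidPDE.FluidComputer (E3 Vel)
open Summit.NavierStokesRegularity.FluidComputer.PalasekTowerClayBridge

namespace TriggerScheme

/-- A trigger pushes at most `ε A₀` per unit speed: `‖g t x‖ ≤ ε · A 0` (`IsTrigger.small` at order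
`0`). [cite: FeffermanClay2006, (C) (5)] -/
theorem IsTrigger.norm_le {𝒮 : TriggerScheme} {ε δ T : ℝ} {g : ℝ → Vel} (hg : 𝒮.IsTrigger ε δ T g)
    (t : ℝ) (x : E3) : ‖g t x‖ ≤ ε * 𝒮.A 0 := by
  have h := hg.small 0 (t, x)
  rwa [norm_iteratedFDeriv_zero] at h

variable (𝒮 : TriggerScheme)

/-- **LINE CROSSING IN ONE TRIGGERED TRANSFER.** Let `g` be an admissible trigger of amplitude `ε` for
the window `[0, T]` (`T > 0`, `0 ≤ δ`), `(u, p)` a finite-energy classical solution of the system forced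
by `g` on `[0, T + δ]` (`ν > 0`) whose datum `u 0` is a Clay datum bounded by `A ≥ 0`, and suppose the
speed `B` is reached at the hand-over time `T`. Then for every slope `0 ≤ Λ` with `Λ T < B − A` there are
`t⋆ ∈ (0, T]` and a global argmax `x₁` of `‖u(t⋆, ·)‖` with `‖u(t⋆, x₁)‖ = B − Λ (T − t⋆) ∈ (A, B]`,
exceeding every earlier speed, `Λ‖u‖ ≤ ⟪u, ∂ₜu⟫`, the hitting inequality with drift
`ν|Du|²_F + ⟪u, ∇p⟫ + Λ‖u‖ ≤ ⟪u, g⟫`, and — since `‖g‖ ≤ ε A₀` — the PRESSURE RATE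
`ν|Du|²_F + (Λ − ε A₀)‖u‖ ≤ −⟪u, ∇p⟫`. [cite: Tao2016AveragedNS, §1.3] -/
theorem exists_lineCrossing_of_trigger {ν ε δ T : ℝ} (hν : 0 < ν) (hT : 0 < T) (hδ : 0 ≤ δ)
    {g u : ℝ → Vel} {p : ℝ → E3 → ℝ} (hg : 𝒮.IsTrigger ε δ T g)
    (hcl : IsClassicalNSSolutionOn (Icc 0 (T + δ)) ν g u p) (h₀ : HasRapidSpatialDecay (u 0))
    (hE : ∃ C : ℝ≥0∞, C < ⊤ ∧ ∀ t ∈ Icc 0 (T + δ), ∫⁻ x, ‖u t x‖ₑ ^ 2 ≤ C)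
    {A B Λ : ℝ} (hA0 : 0 ≤ A) (hA : ∀ x, ‖u 0 x‖ ≤ A) (hB : ∃ x, B ≤ ‖u T x‖)
    (hΛ0 : 0 ≤ Λ) (hΛ : Λ * T < B - A) :
    ∃ t₀ ∈ Ioc 0 T, ∃ x₀ : E3,
      ‖u t₀ x₀‖ = B - Λ * (T - t₀) ∧ A < ‖u t₀ x₀‖ ∧ ‖u t₀ x₀‖ ≤ B ∧
      (∀ x, ‖u t₀ x‖ ≤ ‖u t₀ x₀‖) ∧
      (∀ t ∈ Ico 0 t₀, ∀ x, ‖u t x‖ < ‖u t₀ x₀‖) ∧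
      Λ * ‖u t₀ x₀‖ ≤ ⟪u t₀ x₀, timeDerivWithin (Icc 0 (T + δ)) u t₀ x₀⟫ ∧
      ν * frobeniusNormSq (fderiv ℝ (u t₀) x₀) + ⟪u t₀ x₀, gradient (p t₀) x₀⟫ + Λ * ‖u t₀ x₀‖ ≤
        ⟪u t₀ x₀, g t₀ x₀⟫ ∧
      ν * frobeniusNormSq (fderiv ℝ (u t₀) x₀) + (Λ - ε * 𝒮.A 0) * ‖u t₀ x₀‖ ≤
        - ⟪u t₀ x₀, gradient (p t₀) x₀⟫ := by
  obtain ⟨hfs, hfd⟩ := hg.clayForce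
  have hTδ : 0 < T + δ := by linarith
  set L₁ : ℝ := B - Λ * T with hL₁def
  have hL₁A : A < L₁ := by simp only [hL₁def]; linarith
  have hL₁ : 0 < L₁ := lt_of_le_of_lt hA0 hL₁A
  have hL₂ : 0 < L₁ + Λ * (T - 0) := by
    have : L₁ + Λ * (T - 0) = B := by simp only [hL₁def]; ring
    rw [this]; linarith [mul_nonneg hΛ0 hT.le]
  have hbefore : ∀ t ∈ Icc (0 : ℝ) 0, ∀ x, ‖u t x‖ < L₁ := by
    intro t ht x
    have ht0 : t = 0 := le_antisymm ht.2 ht.1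
    rw [ht0]; exact lt_of_le_of_lt (hA x) hL₁A
  have hreach : ∃ x, L₁ + Λ * (T - 0) ≤ ‖u T x‖ := by
    obtain ⟨x, hx⟩ := hB
    exact ⟨x, by simp only [hL₁def]; linarith⟩
  obtain ⟨t₀, ht₀, x₀, hval, hmax, hstrict, htime, hineq⟩ :=
    exists_lineCrossing_of_clayContinuation hν hTδ hcl h₀ hfs hfd hE le_rfl hT.le (by linarith)
      hL₁ hL₂ hbefore hreach
  have hval' : ‖u t₀ x₀‖ = B - Λ * (T - t₀) := by rw [hval]; simp only [hL₁def]; ring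
  have hlow : A < ‖u t₀ x₀‖ := by
    rw [hval']
    have : Λ * (T - t₀) ≤ Λ * T := mul_le_mul_of_nonneg_left (by linarith [ht₀.1]) hΛ0
    linarith
  have hupp : ‖u t₀ x₀‖ ≤ B := by
    rw [hval']
    have : 0 ≤ Λ * (T - t₀) := mul_nonneg hΛ0 (by linarith [ht₀.2])
    linarith
  have hstrict' : ∀ t ∈ Ico 0 t₀, ∀ x, ‖u t x‖ < ‖u t₀ x₀‖ := by
    intro t ht x
    refine lt_of_lt_of_le (hstrict t ht x) ?_
    rw [hval]
    have hm : Λ * max (t - 0) 0 ≤ Λ * (t₀ - 0) :=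
      mul_le_mul_of_nonneg_left (max_le (by linarith [ht.2]) (by linarith [ht₀.1])) hΛ0
    linarith
  refine ⟨t₀, ht₀, x₀, hval', hlow, hupp, hmax, hstrict', htime, hineq, ?_⟩
  have hf : ⟪u t₀ x₀, g t₀ x₀⟫ ≤ ε * 𝒮.A 0 * ‖u t₀ x₀‖ :=
    calc ⟪u t₀ x₀, g t₀ x₀⟫ ≤ ‖u t₀ x₀‖ * ‖g t₀ x₀‖ := real_inner_le_norm _ _
      _ ≤ ‖u t₀ x₀‖ * (ε * 𝒮.A 0) := mul_le_mul_of_nonneg_left (hg.norm_le t₀ x₀) (norm_nonneg _)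
      _ = ε * 𝒮.A 0 * ‖u t₀ x₀‖ := by ring
  nlinarith

/-- The hand-over state of a step carries the next level's speed floor, zoomed: if
`u T = (x ↦ λ • w' (λ • (x − x₀)))` with `w' ∈ F U'`, `U' ≥ U⋆`, then `‖u T x‖ ≥ λ c U'` at the point
`x = x₀ + λ⁻¹ • y` above a floor point `y` of `w'`. [cite: Tao2016AveragedNS, §1.3] -/
theorem exists_handover_floor {u : ℝ → Vel} {T U' : ℝ} {w' : Vel} {x₀ : E3} (hU' : 𝒮.UStar ≤ U')
    (hw' : w' ∈ 𝒮.F U') (hT : u T = fun x => 𝒮.lam • w' (𝒮.lam • (x - x₀))) :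
    ∃ x : E3, 𝒮.lam * (𝒮.c * U') ≤ ‖u T x‖ := by
  obtain ⟨y, -, hy⟩ := 𝒮.floor U' hU' w' hw'
  have hlam : 0 < 𝒮.lam := 𝒮.lam_pos
  refine ⟨x₀ + 𝒮.lam⁻¹ • y, ?_⟩
  rw [hT]
  simp only [add_sub_cancel_left, smul_smul, mul_inv_cancel₀ hlam.ne', one_smul, norm_smul,
    Real.norm_eq_abs, abs_of_pos hlam]
  exact mul_le_mul_of_nonneg_left hy hlam.le

/-- **THE PRESSURE RATE OF ONE TRIGGERED TRANSFER (hand-over form).** In the data of a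
`TriggerScheme.Step` — trigger `g` of amplitude `ε ≥ 0` for `[0, T]`, `0 < δ`, a finite-energy classical
solution `(u, p)` forced by `g` on `[0, T + δ]` from a Clay datum bounded by `A ≥ 0`, handing over at `T`
the `λ`-zoom of a member `w' ∈ F U'` (`U' ≥ U⋆`) — the speed maximum climbs from `≤ A` to `≥ λ c U'`, so
for every slope `0 ≤ Λ` with `Λ T < λ c U' − A`, at some `t⋆ ∈ (0, T]` and global argmax `x₁` (speed in
`(A, λ c U']`, exceeding every earlier speed) THE PRESSURE GRADIENT accelerates the fluid at rate at
least `Λ − ε A₀` against its own viscous rate: `ν|Du|²_F + (Λ − ε A₀)‖u‖ ≤ −⟪u, ∇p⟫`. A necessary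
condition on every step of every scheme; no instance is claimed. [cite: Tao2016AveragedNS, §1.3] -/
theorem exists_pressureRate_of_handover {ν ε δ T : ℝ} (hν : 0 < ν) (hT : 0 < T) (hδ : 0 ≤ δ)
    {g u : ℝ → Vel} {p : ℝ → E3 → ℝ} (hg : 𝒮.IsTrigger ε δ T g)
    (hcl : IsClassicalNSSolutionOn (Icc 0 (T + δ)) ν g u p) (h₀ : HasRapidSpatialDecay (u 0))
    (hE : ∃ C : ℝ≥0∞, C < ⊤ ∧ ∀ t ∈ Icc 0 (T + δ), ∫⁻ x, ‖u t x‖ₑ ^ 2 ≤ C)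
    {A : ℝ} (hA0 : 0 ≤ A) (hA : ∀ x, ‖u 0 x‖ ≤ A)
    {U' : ℝ} {w' : Vel} {x₀ : E3} (hU' : 𝒮.UStar ≤ U') (hw' : w' ∈ 𝒮.F U')
    (hhand : u T = fun x => 𝒮.lam • w' (𝒮.lam • (x - x₀)))
    {Λ : ℝ} (hΛ0 : 0 ≤ Λ) (hΛ : Λ * T < 𝒮.lam * (𝒮.c * U') - A) :
    ∃ t₀ ∈ Ioc 0 T, ∃ x₁ : E3,
      A < ‖u t₀ x₁‖ ∧ ‖u t₀ x₁‖ ≤ 𝒮.lam * (𝒮.c * U') ∧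
      (∀ x, ‖u t₀ x‖ ≤ ‖u t₀ x₁‖) ∧
      (∀ t ∈ Ico 0 t₀, ∀ x, ‖u t x‖ < ‖u t₀ x₁‖) ∧
      Λ * ‖u t₀ x₁‖ ≤ ⟪u t₀ x₁, timeDerivWithin (Icc 0 (T + δ)) u t₀ x₁⟫ ∧
      ν * frobeniusNormSq (fderiv ℝ (u t₀) x₁) + (Λ - ε * 𝒮.A 0) * ‖u t₀ x₁‖ ≤
        - ⟪u t₀ x₁, gradient (p t₀) x₁⟫ := by
  obtain ⟨t₀, ht₀, x₁, -, hlow, hupp, hmax, hstrict, htime, -, hP⟩ :=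
    𝒮.exists_lineCrossing_of_trigger hν hT hδ hg hcl h₀ hE hA0 hA
      (𝒮.exists_handover_floor hU' hw' hhand) hΛ0 hΛ
  exact ⟨t₀, ht₀, x₁, hlow, hupp, hmax, hstrict, htime, hP⟩

/-- **Every `Step` from a bounded Clay datum is pressure-driven at the mean rate** (packaged on the
predicate): if `𝒮.Step ν U ε w` holds (`ν > 0`, `U ≥ U⋆`), `w` is a Clay datum with `‖w‖ ≤ A`
(`0 ≤ A`), then its data `T, δ, g, u, p, U', w', x₀` exhibit, for every slope `0 ≤ Λ` with
`Λ T < λ c U' − A`, an instant `t⋆ ∈ (0, T]` and a global argmax where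
`ν|Du|²_F + (Λ − ε A₀)‖u‖ ≤ −⟪u, ∇p⟫`; and `T ≤ C_τ (1 + |log ε|)^q / U`, `U' ≥ (ηλ)^{1/2} U`.
[cite: Tao2016AveragedNS, §1.3] -/
theorem Step.exists_pressureRate {ν U ε : ℝ} {w : Vel} (hν : 0 < ν) (h : 𝒮.Step ν U ε w)
    (hU : 𝒮.UStar ≤ U) (hw : HasRapidSpatialDecay w) {A : ℝ} (hA0 : 0 ≤ A) (hA : ∀ x, ‖w x‖ ≤ A) :
    ∃ (T δ : ℝ) (g u : ℝ → Vel) (p : ℝ → E3 → ℝ) (U' : ℝ),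
      0 < δ ∧ 2 * δ < T ∧ T ≤ 𝒮.Cτ * (1 + |Real.log ε|) ^ 𝒮.q / U ∧ 𝒮.growth * U ≤ U' ∧
      𝒮.IsTrigger ε δ T g ∧ IsClassicalNSSolutionOn (Icc 0 (T + δ)) ν g u p ∧ u 0 = w ∧
      ∀ Λ : ℝ, 0 ≤ Λ → Λ * T < 𝒮.lam * (𝒮.c * U') - A →
        ∃ t₀ ∈ Ioc 0 T, ∃ x₁ : E3,
          A < ‖u t₀ x₁‖ ∧ ‖u t₀ x₁‖ ≤ 𝒮.lam * (𝒮.c * U') ∧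
          (∀ x, ‖u t₀ x‖ ≤ ‖u t₀ x₁‖) ∧
          (∀ t ∈ Ico 0 t₀, ∀ x, ‖u t x‖ < ‖u t₀ x₁‖) ∧
          ν * frobeniusNormSq (fderiv ℝ (u t₀) x₁) + (Λ - ε * 𝒮.A 0) * ‖u t₀ x₁‖ ≤
            - ⟪u t₀ x₁, gradient (p t₀) x₁⟫ := by
  obtain ⟨T, δ, g, u, p, hδ, h2δ, hTle, hg, hcl, hu0, hE, U', w', x₀, hU', hw', -, hhand⟩ := h
  have hT : 0 < T := by linarith
  have h₀ : HasRapidSpatialDecay (u 0) := by rw [hu0]; exact hw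
  have hA' : ∀ x, ‖u 0 x‖ ≤ A := fun x => by rw [hu0]; exact hA x
  refine ⟨T, δ, g, u, p, U', hδ, h2δ, hTle, hU', hg, hcl, hu0, fun Λ hΛ0 hΛ => ?_⟩
  have hU0 : 0 ≤ U := 𝒮.UStar_pos.le.trans hU
  have hUStar : 𝒮.UStar ≤ U' :=
    hU.trans ((le_mul_of_one_le_left hU0 𝒮.one_lt_growth.le).trans hU')
  obtain ⟨t₀, ht₀, x₁, hlow, hupp, hmax, hstrict, -, hP⟩ :=
    𝒮.exists_pressureRate_of_handover hν hT hδ.le hg hcl h₀ hE hA0 hA' hUStar hw' hhand hΛ0 hΛ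
  exact ⟨t₀, ht₀, x₁, hlow, hupp, hmax, hstrict, hP⟩

end TriggerScheme

end Summit.NavierStokesRegularity.FluidComputer.TriggeredTransfer

end
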